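import Literature.IUT.HodgeArakelov.BadPrimeGaussianMonoidsGenuineRecordRootsOfTranslates
import Literature.IUT.HodgeArakelov.BadPrimeGaussianMonoidsCor36GenuineRecordFamilyOfTower
import Literature.IUT.HodgeArakelov.EtaleThetaDataOfSettingCyclotomeTower
import Literature.IUT.HodgeArakelov.MonoThetaProjectiveBridgeEtTh

/-!
# [IUTchII] Cor 3.5 (ii) / Cor 3.6 (ii) at the genuine `θ_env` data with PRINT'S constant monoid `𝒪^▷_{ℚ̄_p}` and every model-data
# input discharged: `hker` from the standing cyclotome identifications `mods`, `horb` / `hroots` for the pair action, and the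
# `∞`-level «↷» family with print's root condition DISCHARGED (proof-only; row «COR35ii-HORB-GENUINE», file 7)

S. Mochizuki, *Inter-universal Teichmüller theory II*, kurims Dec-2020 manuscript, Prop 1.4 p. 27, Prop 2.2 (ii) p. 66, Cor 2.8 (i) p. 82,
Prop 3.1 (i)(ii) pp. 87–88, Cor 3.5 (ii) p. 95, Cor 3.6 (ii) p. 100 [cite: Mochizuki2012, Cor 3.6 (ii) p.100]; [EtTh] Cor 2.19 (ii) p. 64 (the
cyclotome identifications `μ_M ≅ (l·Δ_Θ) ⊗ ℤ/Mℤ`). Claim key `Mochizuki2012` DISPUTED (D-0012). PROOF-ONLY companion (abc-iut cell, layer L6,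
seat abc-iut-w4-d004 gen 4; nodes **IUTchII:Cor3.5(ii)** / **IUTchII:Cor3.6(ii)**). NO definition, NO `Prop` fact, NO instance; consumed
BY NAME: abc-iut-w4-d041's `hfix_of_cyclotomeTower`, abc-iut-L6-d6's `EtaleLevels.cyclotomeTower` (the `CyclotomeTower` ON A CHAIN built
from the standing data `mods`/`hmods` of the genuine `θ_env` datum — so NO extra tower binder), abc-iut-w4-d030's `bijective_rigidLimHom`
(`hlim` discharged), abc-iut-w4-d007/abc-iut-w5-d192's `𝒪^▷` bookkeeping (`mem_comap_nonzeroIntegers_padic_of_isOfFinOrder'`,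
`smul_mem_comap_nonzeroIntegers_padic`, `exists_cyclotomeCoefficients_mods`, `cor36ii_infty_toRecord_family_of_mem_thetaEnv`), and files 1/3
of this row.

* `hker_coh_of_mods` — `Ker(H¹(Π^tp_{Ÿ̲̲}, l·Δ_Θ) → lim_J) ⊆ torsion` at the model from `IsEtThOrigin` and the STANDING identifications
  `mods`/`hmods` alone (the chain tower `cyclotomeTower mods hmods` on `{1}` feeds `hfix_of_cyclotomeTower`);
* `horb_toRecord_nonzeroIntegers_pairRhoLim` / `hroots_toRecord_nonzeroIntegers_pairRhoLim` — the Cor 3.5 (ii) inputs `horb` / `hroots`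
  at the genuine record over `𝒪^▷_{ℚ̄_p}` (`hlim`, `hOtors`, `hker` DISCHARGED; left: (R1)(R2)(R3), `IsEtThOrigin`, bijective `c`);
* **`cor36ii_infty_toRecord_family_nonzeroIntegers_pairRhoLim`** — abc-iut-w5-d192's `∞`-level «↷» family theorem at print's `O` with its
  root-condition binder DISCHARGED (for `i = i₀` = the pair's label).
HONEST FRAMING: composition of landed theorems; nothing disputed is asserted; no side is taken on [IUTchIII] Cor 3.12; typed ≠ proved.
-/

noncomputable section

namespace Literature.IUT.HodgeArakelov

namespace EtaleLevels

open Literature.AnabelianGeometry.EtaleTheta CohomologySystemOfContH1 EtaleThetaDataOfSetting TemperedThetaMonoids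
  BadPrimeGaussianMonoids Literature.AnabelianGeometry.AbsoluteAnabelian

variable {p : ℕ} [Fact p.Prime] {D : Literature.AnabelianGeometry.EtaleTheta.ThetaSetting p}
  {E : D.EtaleThetaData} {l : ℕ} (C : E.DoubleUnderline l) (hC : D.Compat) (hS : D.Sec2Hyps)
  (hl : l.Prime) (hp2 : p ≠ 2) (hpl : p ≠ l) (hζ : ∃ ζ : D.K, IsPrimitiveRoot ζ (4 * l))
  (mods : ∀ M : ℕ+, D.CyclotomeMod l M)
  (f : contCocycles D.toTheta D.DeltaTheta C.GtpYdduu) (hf : f ∈ C.rootCocycles hC)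
  (hmods : ∀ (M M' : ℕ+) (h : (M : ℕ) ∣ (M' : ℕ)) (x : D.lDeltaTheta l),
    MuN.red p M M' h ((mods M').red x) = (mods M).red x)
  (h15 : Literature.AnabelianGeometry.EtaleTheta.ThetaSetting.Prop15iii E hC) (L : C.CuspLabels)
  (hZ : ∀ M : ℕ+, Nonempty (ModelCyclotomes.lDeltaQuot (C.rigidData (mods M) hC hS h15 L) ≃*
    Literature.IUT.HodgeTheaters.ZHat))
  (hcharY : EtaleThetaDataOfSetting.PiYddCharacteristic C)
  [(EtaleThetaDataOfSetting.PiYdd C).Normal]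

omit [(EtaleThetaDataOfSetting.PiYdd C).Normal] in
include hmods in
/-- **`Ker(H¹(Π^tp_{Ÿ̲̲}, l·Δ_Θ) → lim_J) ⊆ torsion` from the STANDING cyclotome identifications** (`mods`, `hmods`: [EtTh] Cor 2.19 (ii)
`μ_M ≅ (l·Δ_Θ) ⊗ ℤ/Mℤ` at all levels, compatibly) and `IsEtThOrigin`: abc-iut-L6-d6's chain tower `cyclotomeTower mods hmods` (here on the
trivial chain `{1}`) is a `CyclotomeTower`, so abc-iut-w4-d041's `hfix_of_cyclotomeTower` applies — no extra tower binder is needed at the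
genuine `θ_env` data. [cite: MochizukiEtTh2009, Cor 2.19(ii) p.64] -/
theorem hker_coh_of_mods (hO' : D.IsEtThOrigin) :
    ∀ y : (coh C).H1 ⊤, (coh C).toLim ⊤ y = 0 → IsOfFinAddOrder y :=
  hker_coh_of_fixed C (hfix_of_cyclotomeTower C hO' (cyclotomeTower mods hmods (dvd_refl ((1 : ℕ+) : ℕ))))

section Record

variable (c : CyclotomeCoefficients (phi C) (D.lDeltaTheta l) (PadicAlgCl p)ˣ)
  {Iota : Type}
  (iota : Iota → ((thetaEnvData C hC hS hl hp2 hpl hζ mods f hf hmods h15 L hZ hcharY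
      (bijective_rigidLimHom C hC hS hl hp2 hpl hζ mods f hf hmods h15 L hZ)).D.coh.lim ≃+
    (thetaEnvData C hC hS hl hp2 hpl hζ mods f hf hmods h15 L hZ hcharY
      (bijective_rigidLimHom C hC hS hl hp2 hpl hζ mods f hf hmods h15 L hZ)).D.coh.lim))

/-- **The Cor 3.5 (ii) input `horb` at the genuine record over PRINT'S `𝒪^▷_{ℚ̄_p}`, model data discharged** (`hlim :=
bijective_rigidLimHom`, `μ ⊆ 𝒪^▷`, `hker` from `mods`): `θ^{i₀}_env(𝕄_*)` is ONE `M^×_TM`-orbit for any inversion family with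
`iota i₀ = pairRhoLim C αι βι …`. Left: (R1)(R2)(R3), `IsEtThOrigin`, bijective `c`. [cite: Mochizuki2012, Cor 2.8 (i) p.82] -/
theorem horb_toRecord_nonzeroIntegers_pairRhoLim (hO' : D.IsEtThOrigin) (hc : Function.Bijective c.hom)
    -- (R1) the pointed-inversion PAIR, reversing the `ℤ`-torsor
    (αι : (Pi C) ≃ₜ* (Pi C)) (βι : D.GtpTheta ≃ₜ* D.GtpTheta) (hφαβ : ∀ g, βι (phi C g) = phi C (αι g))
    (hAβ : ∀ a : D.GtpTheta, a ∈ D.lDeltaTheta l ↔ βι a ∈ D.lDeltaTheta l)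
    (hH : ∀ x, x ∈ PiYdd C ↔ αι x ∈ PiYdd C)
    (γ ε : Pi C) (hγ : C.toLZ γ = Multiplicative.ofAdd 1) (hε₁ : (ε : D.PiTemp) ∈ D.GtpY)
    (hε₂ : (ε : D.PiTemp) ∉ D.GtpYdd) (hαγ : C.toLZ (αι γ) = Multiplicative.ofAdd (-1))
    -- (R2)(R3) [EtTh] Prop 1.4 at the class level
    (hsign : ∃ κ : ContH1 (phi C) (D.lDeltaTheta l) (PiYdd C ⊓ ⊤), κ ^ 2 = 1 ∧
      ContH1.conj (phi C) (D.lDeltaTheta l) ε (rootLiftClass C) = rootLiftClass C * κ)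
    (hroot : ∃ τ₀ : Pi C, (τ₀ : D.PiTemp) ∈ D.GtpY ∧
      h1TopAut (phi C) (D.lDeltaTheta l) (PiYdd C) αι βι hφαβ (fun a ha => (hAβ a).mp ha) hH (rootLiftClass C) =
        ContH1.conj (phi C) (D.lDeltaTheta l) τ₀ (rootLiftClass C))
    (hfree : ∀ m n : ℤ, IsOfFinAddOrder
      ((h1Top C).symm (Additive.ofMul (ContH1.conj (phi C) (D.lDeltaTheta l) (γ ^ m) (rootLiftClass C))) -
        (h1Top C).symm (Additive.ofMul (ContH1.conj (phi C) (D.lDeltaTheta l) (γ ^ n) (rootLiftClass C)))) →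
      m = n)
    {i₀ : Iota} (hi₀ : iota i₀ = pairRhoLim C αι βι hφαβ hAβ hH)
    {θ : ((thetaEnvData C hC hS hl hp2 hpl hζ mods f hf hmods h15 L hZ hcharY
          (bijective_rigidLimHom C hC hS hl hp2 hpl hζ mods f hf hmods h15 L hZ)).toRecord
          (h1LimConjMulAut (phi C) (D.lDeltaTheta l) (PiYdd C)) (h1LimKummerOn (phi C) (D.lDeltaTheta l) (PiYdd C) c
            (isOpen_stabilizer_units C) (finiteIndex_stabilizer_units C)
            ((nonzeroIntegers ℚ_[p] (PadicAlgCl p)).comap (Units.coeHom (PadicAlgCl p)))) iota).H}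
    (hθ : θ ∈ ((thetaEnvData C hC hS hl hp2 hpl hζ mods f hf hmods h15 L hZ hcharY
          (bijective_rigidLimHom C hC hS hl hp2 hpl hζ mods f hf hmods h15 L hZ)).toRecord
          (h1LimConjMulAut (phi C) (D.lDeltaTheta l) (PiYdd C)) (h1LimKummerOn (phi C) (D.lDeltaTheta l) (PiYdd C) c
            (isOpen_stabilizer_units C) (finiteIndex_stabilizer_units C)
            ((nonzeroIntegers ℚ_[p] (PadicAlgCl p)).comap (Units.coeHom (PadicAlgCl p)))) iota).thetaEnv i₀) :
    ∀ θ' ∈ ((thetaEnvData C hC hS hl hp2 hpl hζ mods f hf hmods h15 L hZ hcharY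
          (bijective_rigidLimHom C hC hS hl hp2 hpl hζ mods f hf hmods h15 L hZ)).toRecord
          (h1LimConjMulAut (phi C) (D.lDeltaTheta l) (PiYdd C)) (h1LimKummerOn (phi C) (D.lDeltaTheta l) (PiYdd C) c
            (isOpen_stabilizer_units C) (finiteIndex_stabilizer_units C)
            ((nonzeroIntegers ℚ_[p] (PadicAlgCl p)).comap (Units.coeHom (PadicAlgCl p)))) iota).thetaEnv i₀,
      ∃ u ∈ ((thetaEnvData C hC hS hl hp2 hpl hζ mods f hf hmods h15 L hZ hcharY
          (bijective_rigidLimHom C hC hS hl hp2 hpl hζ mods f hf hmods h15 L hZ)).toRecord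
          (h1LimConjMulAut (phi C) (D.lDeltaTheta l) (PiYdd C)) (h1LimKummerOn (phi C) (D.lDeltaTheta l) (PiYdd C) c
            (isOpen_stabilizer_units C) (finiteIndex_stabilizer_units C)
            ((nonzeroIntegers ℚ_[p] (PadicAlgCl p)).comap (Units.coeHom (PadicAlgCl p)))) iota).units, θ' = u * θ :=
  horb_toRecord_pairRhoLim C hC hS hl hp2 hpl hζ mods f hf hmods h15 L hZ hcharY
    (bijective_rigidLimHom C hC hS hl hp2 hpl hζ mods f hf hmods h15 L hZ) iota c (isOpen_stabilizer_units C)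
    (finiteIndex_stabilizer_units C) ((nonzeroIntegers ℚ_[p] (PadicAlgCl p)).comap (Units.coeHom (PadicAlgCl p))) hc
    (fun _ ha => ⟨mem_comap_nonzeroIntegers_padic_of_isOfFinOrder' ha, mem_comap_nonzeroIntegers_padic_of_isOfFinOrder' ha.inv⟩)
    αι βι hφαβ hAβ hH γ ε hγ hε₁ hε₂ hαγ hsign hroot hfree (hker_coh_of_mods C mods hmods hO') hi₀ hθ

/-- **Print's root condition `hroots` at the genuine record over PRINT'S `𝒪^▷_{ℚ̄_p}`, model data discharged** (`hlim`, `μ ⊆ 𝒪^▷`,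
`hker`): every `ϑ ∈ ∞θ^{i₀}_env(𝕄_*)` has a positive power in `M^×_TM · θ^ℕ`, for any inversion family with `iota i₀ = pairRhoLim C αι βι …`.
Left: (R1)(R2)(R3), `IsEtThOrigin`, bijective `c`. [cite: Mochizuki2012, Cor 3.5 (ii) p.95] -/
theorem hroots_toRecord_nonzeroIntegers_pairRhoLim (hO' : D.IsEtThOrigin) (hc : Function.Bijective c.hom)
    -- (R1) the pointed-inversion PAIR, reversing the `ℤ`-torsor
    (αι : (Pi C) ≃ₜ* (Pi C)) (βι : D.GtpTheta ≃ₜ* D.GtpTheta) (hφαβ : ∀ g, βι (phi C g) = phi C (αι g))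
    (hAβ : ∀ a : D.GtpTheta, a ∈ D.lDeltaTheta l ↔ βι a ∈ D.lDeltaTheta l)
    (hH : ∀ x, x ∈ PiYdd C ↔ αι x ∈ PiYdd C)
    (γ ε : Pi C) (hγ : C.toLZ γ = Multiplicative.ofAdd 1) (hε₁ : (ε : D.PiTemp) ∈ D.GtpY)
    (hε₂ : (ε : D.PiTemp) ∉ D.GtpYdd) (hαγ : C.toLZ (αι γ) = Multiplicative.ofAdd (-1))
    -- (R2)(R3) [EtTh] Prop 1.4 at the class level
    (hsign : ∃ κ : ContH1 (phi C) (D.lDeltaTheta l) (PiYdd C ⊓ ⊤), κ ^ 2 = 1 ∧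
      ContH1.conj (phi C) (D.lDeltaTheta l) ε (rootLiftClass C) = rootLiftClass C * κ)
    (hroot : ∃ τ₀ : Pi C, (τ₀ : D.PiTemp) ∈ D.GtpY ∧
      h1TopAut (phi C) (D.lDeltaTheta l) (PiYdd C) αι βι hφαβ (fun a ha => (hAβ a).mp ha) hH (rootLiftClass C) =
        ContH1.conj (phi C) (D.lDeltaTheta l) τ₀ (rootLiftClass C))
    (hfree : ∀ m n : ℤ, IsOfFinAddOrder
      ((h1Top C).symm (Additive.ofMul (ContH1.conj (phi C) (D.lDeltaTheta l) (γ ^ m) (rootLiftClass C))) -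
        (h1Top C).symm (Additive.ofMul (ContH1.conj (phi C) (D.lDeltaTheta l) (γ ^ n) (rootLiftClass C)))) →
      m = n)
    {i₀ : Iota} (hi₀ : iota i₀ = pairRhoLim C αι βι hφαβ hAβ hH)
    {θ : ((thetaEnvData C hC hS hl hp2 hpl hζ mods f hf hmods h15 L hZ hcharY
          (bijective_rigidLimHom C hC hS hl hp2 hpl hζ mods f hf hmods h15 L hZ)).toRecord
          (h1LimConjMulAut (phi C) (D.lDeltaTheta l) (PiYdd C)) (h1LimKummerOn (phi C) (D.lDeltaTheta l) (PiYdd C) c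
            (isOpen_stabilizer_units C) (finiteIndex_stabilizer_units C)
            ((nonzeroIntegers ℚ_[p] (PadicAlgCl p)).comap (Units.coeHom (PadicAlgCl p)))) iota).H}
    (hθ : θ ∈ ((thetaEnvData C hC hS hl hp2 hpl hζ mods f hf hmods h15 L hZ hcharY
          (bijective_rigidLimHom C hC hS hl hp2 hpl hζ mods f hf hmods h15 L hZ)).toRecord
          (h1LimConjMulAut (phi C) (D.lDeltaTheta l) (PiYdd C)) (h1LimKummerOn (phi C) (D.lDeltaTheta l) (PiYdd C) c
            (isOpen_stabilizer_units C) (finiteIndex_stabilizer_units C)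
            ((nonzeroIntegers ℚ_[p] (PadicAlgCl p)).comap (Units.coeHom (PadicAlgCl p)))) iota).thetaEnv i₀) :
    ∀ ϑ ∈ ((thetaEnvData C hC hS hl hp2 hpl hζ mods f hf hmods h15 L hZ hcharY
          (bijective_rigidLimHom C hC hS hl hp2 hpl hζ mods f hf hmods h15 L hZ)).toRecord
          (h1LimConjMulAut (phi C) (D.lDeltaTheta l) (PiYdd C)) (h1LimKummerOn (phi C) (D.lDeltaTheta l) (PiYdd C) c
            (isOpen_stabilizer_units C) (finiteIndex_stabilizer_units C)
            ((nonzeroIntegers ℚ_[p] (PadicAlgCl p)).comap (Units.coeHom (PadicAlgCl p)))) iota).inftyThetaEnv i₀,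
      ∃ N : ℕ, 0 < N ∧ ϑ ^ N ∈ splitMonoid ((thetaEnvData C hC hS hl hp2 hpl hζ mods f hf hmods h15 L hZ hcharY
          (bijective_rigidLimHom C hC hS hl hp2 hpl hζ mods f hf hmods h15 L hZ)).toRecord
          (h1LimConjMulAut (phi C) (D.lDeltaTheta l) (PiYdd C)) (h1LimKummerOn (phi C) (D.lDeltaTheta l) (PiYdd C) c
            (isOpen_stabilizer_units C) (finiteIndex_stabilizer_units C)
            ((nonzeroIntegers ℚ_[p] (PadicAlgCl p)).comap (Units.coeHom (PadicAlgCl p)))) iota).units (Submonoid.powers θ) :=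
  hroots_toRecord_pairRhoLim C hC hS hl hp2 hpl hζ mods f hf hmods h15 L hZ hcharY
    (bijective_rigidLimHom C hC hS hl hp2 hpl hζ mods f hf hmods h15 L hZ) c (isOpen_stabilizer_units C)
    (finiteIndex_stabilizer_units C) ((nonzeroIntegers ℚ_[p] (PadicAlgCl p)).comap (Units.coeHom (PadicAlgCl p))) iota hc
    (fun _ ha => ⟨mem_comap_nonzeroIntegers_padic_of_isOfFinOrder' ha, mem_comap_nonzeroIntegers_padic_of_isOfFinOrder' ha.inv⟩)
    αι βι hφαβ hAβ hH γ ε hγ hε₁ hε₂ hαγ hsign hroot hfree (hker_coh_of_mods C mods hmods hO') hi₀ hθ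

end Record

/-! ### The `∞`-level «↷» family at print's `O` with the root condition discharged -/

section Family

variable {Lbl : Type*} {P₀ : TopGroup.{0}} (φ₀ : P₀ →* D.GtpTheta) (s : Lbl → (P₀ →* Pi C))
  (hι : ∀ t, Continuous ((MonoidHom.id (Pi C)).comp (s t)))
  (hN : ∀ t, (⊤ : Subgroup P₀).map ((MonoidHom.id (Pi C)).comp (s t)) ≤ PiYdd C)
  (hφ : ∀ t, (phi C).comp ((MonoidHom.id (Pi C)).comp (s t)) = φ₀)

include hmods in
/-- **[IUTchII] Cor 3.6 (ii) «↷», `∞`-LEVEL UP TO TORSION, at the genuine `θ_env` data with PRINT'S constant monoid `O := 𝒪^▷_{ℚ̄_p}`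
through `ε`, every model-data input discharged (abc-iut-w5-d192's `cor36ii_infty_toRecord_family_nonzeroIntegers_of_cyclotomeTower_rigid`,
p436909) — NOW ALSO with print's root condition `hroots` DISCHARGED** for any inversion family whose `i₀`-th member is the pair action
`pairRhoLim C αι βι …`: there is a bijective coefficient datum `c`, pinned by the level formula, such that for every such `iota`, every
`θ ∈ θ^{i₀}_env(𝕄_*)`, every family of continuous evaluation sections `s_t` (common `φ₀`, sections of `ε` up to `w`) and every tuple
`y : Lbl → 𝒪^▷_{ℚ̄_p}` with labeled Kummer classes in `∏ R_t(∞Ψ^{i₀}_env)`, the translate `(s_t(g) · y_t)_t` lies there again up to a family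
of ROOTS OF UNITY. Remaining inputs: (R1)(R2)(R3) of [IUTchII] Prop 2.2 (ii) at the model, `IsEtThOrigin`, `IsCompact Δ_Θ`.
[claim: Mochizuki2012, status: disputed] (IUTchII §3 Cor 3.6 (ii), kurims p.100) -/
theorem cor36ii_infty_toRecord_family_nonzeroIntegers_pairRhoLim (hO' : D.IsEtThOrigin)
    (hΔ : IsCompact (D.DeltaTheta : Set D.GtpTheta)) (w : P₀ →* Literature.AnabelianGeometry.SemiGraphs.GQp p)
    (hsec : ∀ t g, aug C (s t g) = w g)
    -- (R1) the pointed-inversion PAIR, reversing the `ℤ`-torsor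
    (αι : (Pi C) ≃ₜ* (Pi C)) (βι : D.GtpTheta ≃ₜ* D.GtpTheta) (hφαβ : ∀ g, βι (phi C g) = phi C (αι g))
    (hAβ : ∀ a : D.GtpTheta, a ∈ D.lDeltaTheta l ↔ βι a ∈ D.lDeltaTheta l)
    (hH : ∀ x, x ∈ PiYdd C ↔ αι x ∈ PiYdd C)
    (γ ε : Pi C) (hγ : C.toLZ γ = Multiplicative.ofAdd 1) (hε₁ : (ε : D.PiTemp) ∈ D.GtpY)
    (hε₂ : (ε : D.PiTemp) ∉ D.GtpYdd) (hαγ : C.toLZ (αι γ) = Multiplicative.ofAdd (-1))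
    -- (R2)(R3) [EtTh] Prop 1.4 at the class level
    (hsign : ∃ κ : ContH1 (phi C) (D.lDeltaTheta l) (PiYdd C ⊓ ⊤), κ ^ 2 = 1 ∧
      ContH1.conj (phi C) (D.lDeltaTheta l) ε (rootLiftClass C) = rootLiftClass C * κ)
    (hroot : ∃ τ₀ : Pi C, (τ₀ : D.PiTemp) ∈ D.GtpY ∧
      h1TopAut (phi C) (D.lDeltaTheta l) (PiYdd C) αι βι hφαβ (fun a ha => (hAβ a).mp ha) hH (rootLiftClass C) =
        ContH1.conj (phi C) (D.lDeltaTheta l) τ₀ (rootLiftClass C))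
    (hfree : ∀ m n : ℤ, IsOfFinAddOrder
      ((h1Top C).symm (Additive.ofMul (ContH1.conj (phi C) (D.lDeltaTheta l) (γ ^ m) (rootLiftClass C))) -
        (h1Top C).symm (Additive.ofMul (ContH1.conj (phi C) (D.lDeltaTheta l) (γ ^ n) (rootLiftClass C)))) →
      m = n) :
    ∃ c : CyclotomeCoefficients (phi C) (D.lDeltaTheta l) (PadicAlgCl p)ˣ,
      Function.Bijective c.hom ∧
      (∀ (ζ : Literature.AnabelianGeometry.EtaleTheta.cyclotome (PadicAlgCl p)ˣ) (M : ℕ+),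
        (((mods M).red (c.hom ζ) : MuN p M) : (PadicAlgCl p)ˣ) = (ζ : ℕ+ → (PadicAlgCl p)ˣ) M) ∧
      ∀ {Iota : Type}
        (iota : Iota → ((thetaEnvData C hC hS hl hp2 hpl hζ mods f hf hmods h15 L hZ hcharY (bijective_rigidLimHom C hC hS hl hp2 hpl hζ mods f hf hmods h15 L hZ)).D.coh.lim ≃+
          (thetaEnvData C hC hS hl hp2 hpl hζ mods f hf hmods h15 L hZ hcharY (bijective_rigidLimHom C hC hS hl hp2 hpl hζ mods f hf hmods h15 L hZ)).D.coh.lim))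
        {i₀ : Iota} (_ : iota i₀ = pairRhoLim C αι βι hφαβ hAβ hH)
        {θ : ((thetaEnvData C hC hS hl hp2 hpl hζ mods f hf hmods h15 L hZ hcharY (bijective_rigidLimHom C hC hS hl hp2 hpl hζ mods f hf hmods h15 L hZ)).toRecord
          (h1LimConjMulAut (phi C) (D.lDeltaTheta l) (PiYdd C)) (h1LimKummerOn (phi C) (D.lDeltaTheta l) (PiYdd C) c
            (isOpen_stabilizer_units C) (finiteIndex_stabilizer_units C) ((nonzeroIntegers ℚ_[p] (PadicAlgCl p)).comap (Units.coeHom (PadicAlgCl p))))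
          iota).H},
        θ ∈ ((thetaEnvData C hC hS hl hp2 hpl hζ mods f hf hmods h15 L hZ hcharY (bijective_rigidLimHom C hC hS hl hp2 hpl hζ mods f hf hmods h15 L hZ)).toRecord
          (h1LimConjMulAut (phi C) (D.lDeltaTheta l) (PiYdd C)) (h1LimKummerOn (phi C) (D.lDeltaTheta l) (PiYdd C) c
            (isOpen_stabilizer_units C) (finiteIndex_stabilizer_units C) ((nonzeroIntegers ℚ_[p] (PadicAlgCl p)).comap (Units.coeHom (PadicAlgCl p))))
          iota).thetaEnv i₀ →
        ∀ (R : Lbl → (((thetaEnvData C hC hS hl hp2 hpl hζ mods f hf hmods h15 L hZ hcharY (bijective_rigidLimHom C hC hS hl hp2 hpl hζ mods f hf hmods h15 L hZ)).toRecord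
          (h1LimConjMulAut (phi C) (D.lDeltaTheta l) (PiYdd C)) (h1LimKummerOn (phi C) (D.lDeltaTheta l) (PiYdd C) c
            (isOpen_stabilizer_units C) (finiteIndex_stabilizer_units C) ((nonzeroIntegers ℚ_[p] (PadicAlgCl p)).comap (Units.coeHom (PadicAlgCl p))))
          iota).H →* Multiplicative (h1Lim φ₀ (D.lDeltaTheta l) (⊤ : Subgroup P₀) ⊥))),
          (∀ t y, Multiplicative.toAdd (R t y) =
            h1LimCongr (D.lDeltaTheta l) ⊤ (hφ t) ⊥
              (h1LimComap (phi C) (D.lDeltaTheta l) ((MonoidHom.id (Pi C)).comp (s t)) (hι t) (hN t)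
                (AddEquiv.additiveMultiplicative (h1Lim (phi C) (D.lDeltaTheta l) (PiYdd C) ⊥) (Additive.ofMul y)))) →
          ∀ (t₀ : Lbl) (g : P₀) {y : Lbl → ((nonzeroIntegers ℚ_[p] (PadicAlgCl p)).comap (Units.coeHom (PadicAlgCl p)))},
            (fun t => R t (h1LimKummerOn (phi C) (D.lDeltaTheta l) (PiYdd C) c (isOpen_stabilizer_units C)
        (finiteIndex_stabilizer_units C) ((nonzeroIntegers ℚ_[p] (PadicAlgCl p)).comap (Units.coeHom (PadicAlgCl p))) (y t))) ∈
              (((thetaEnvData C hC hS hl hp2 hpl hζ mods f hf hmods h15 L hZ hcharY (bijective_rigidLimHom C hC hS hl hp2 hpl hζ mods f hf hmods h15 L hZ)).toRecord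
          (h1LimConjMulAut (phi C) (D.lDeltaTheta l) (PiYdd C)) (h1LimKummerOn (phi C) (D.lDeltaTheta l) (PiYdd C) c
            (isOpen_stabilizer_units C) (finiteIndex_stabilizer_units C) ((nonzeroIntegers ℚ_[p] (PadicAlgCl p)).comap (Units.coeHom (PadicAlgCl p))))
          iota).inftyThetaMonoid i₀).map (MonoidHom.pi R) →
            ∃ v : Lbl → ((nonzeroIntegers ℚ_[p] (PadicAlgCl p)).comap (Units.coeHom (PadicAlgCl p))),
              (∀ t, IsOfFinOrder (v t)) ∧
              (fun t => R t (h1LimKummerOn (phi C) (D.lDeltaTheta l) (PiYdd C) c (isOpen_stabilizer_units C)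
        (finiteIndex_stabilizer_units C) ((nonzeroIntegers ℚ_[p] (PadicAlgCl p)).comap (Units.coeHom (PadicAlgCl p)))
                  (v t * ⟨(s t g) • ((y t : ((nonzeroIntegers ℚ_[p] (PadicAlgCl p)).comap (Units.coeHom (PadicAlgCl p)))) :
                      (PadicAlgCl p)ˣ), smul_mem_comap_nonzeroIntegers_padic C (s t g) (y t).2⟩))) ∈
                (((thetaEnvData C hC hS hl hp2 hpl hζ mods f hf hmods h15 L hZ hcharY (bijective_rigidLimHom C hC hS hl hp2 hpl hζ mods f hf hmods h15 L hZ)).toRecord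
          (h1LimConjMulAut (phi C) (D.lDeltaTheta l) (PiYdd C)) (h1LimKummerOn (phi C) (D.lDeltaTheta l) (PiYdd C) c
            (isOpen_stabilizer_units C) (finiteIndex_stabilizer_units C) ((nonzeroIntegers ℚ_[p] (PadicAlgCl p)).comap (Units.coeHom (PadicAlgCl p))))
          iota).inftyThetaMonoid i₀).map (MonoidHom.pi R) := by
  obtain ⟨c, hc, hlev⟩ := exists_cyclotomeCoefficients_mods C mods hmods hO' hΔ
  refine ⟨c, hc, hlev, fun {Iota} iota {i₀} hi₀ {θ} hθ R hR t₀ g y hy => ?_⟩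
  exact cor36ii_infty_toRecord_family_of_mem_thetaEnv C hC hS hl hp2 hpl hζ mods f hf hmods h15 L hZ hcharY
    (bijective_rigidLimHom C hC hS hl hp2 hpl hζ mods f hf hmods h15 L hZ) c (isOpen_stabilizer_units C)
    (finiteIndex_stabilizer_units C) ((nonzeroIntegers ℚ_[p] (PadicAlgCl p)).comap (Units.coeHom (PadicAlgCl p)))
    (fun σ _ hb => smul_mem_comap_nonzeroIntegers_padic C σ hb) iota φ₀ s hι hN hφ hc
    (fun _ ha => ⟨mem_comap_nonzeroIntegers_padic_of_isOfFinOrder' ha,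
      mem_comap_nonzeroIntegers_padic_of_isOfFinOrder' ha.inv⟩)
    (fun _ _ hn ha => mem_comap_nonzeroIntegers_of_pow_mem hn ha) (aug C)
    (fun _ hy' a _ => smul_eq_self_of_aug_eq_one C hy' a) w hsec hθ i₀
    (hroots_toRecord_pairRhoLim C hC hS hl hp2 hpl hζ mods f hf hmods h15 L hZ hcharY
      (bijective_rigidLimHom C hC hS hl hp2 hpl hζ mods f hf hmods h15 L hZ) c (isOpen_stabilizer_units C)
      (finiteIndex_stabilizer_units C) ((nonzeroIntegers ℚ_[p] (PadicAlgCl p)).comap (Units.coeHom (PadicAlgCl p))) iota hc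
      (fun _ ha => ⟨mem_comap_nonzeroIntegers_padic_of_isOfFinOrder' ha,
        mem_comap_nonzeroIntegers_padic_of_isOfFinOrder' ha.inv⟩)
      αι βι hφαβ hAβ hH γ ε hγ hε₁ hε₂ hαγ hsign hroot hfree (hker_coh_of_mods C mods hmods hO') hi₀ hθ)
    R hR t₀ g hy


end Family

end EtaleLevels

end Literature.IUT.HodgeArakelov

end
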